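import Literature.AlgebraicGeometry.Morphisms.SmoothOfArtinianLifts            -- ★ [EGA IV₄ 17.14.2] scheme form (B-typ03 (g19), p789896)
import Literature.AlgebraicGeometry.AbelianSchemes.GroupLawLocusOpenImmersion   -- ★ `grpObj_pullback_eq_of_one_fst_eq` (Cor. 6.6 over `T`; B-typ03, p793304)
import Literature.AlgebraicGeometry.AbelianSchemes.AbelianSchemeOverLevelBaseChange -- ★ `AbelianSchemeOver.IsBaseChangeVia` (the (II-a) letter)
import Mathlib.AlgebraicGeometry.Morphisms.Smooth
import Mathlib.AlgebraicGeometry.Morphisms.FiniteType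
import Mathlib.AlgebraicGeometry.Noetherian
import Mathlib.RingTheory.Artinian.Ring
import HarnessLib

/-!
# The law locus is SMOOTH over the base — [MumfordFogartyKirwan1994] Ch. 6 §3, proof of Prop. 6.16 (p. 126): «Proposition 6.15 is precisely
# the criterion for `ω̄` to be smooth (Theorem 3.1, SGA 3)» (PROVED modulo the Prop. 6.15 letter, which enters as a hypothesis)

Topic `Literature/AlgebraicGeometry/AbelianSchemes`; namespace `Literature.AlgebraicGeometry.AbelianSchemes`.  THEOREMS ONLY (no definition, no
named fact, no instance, no notation, no `sorry`).  Cell `hodgecm-mathlib` (D-0151 ∕ D-0183 FLOOR 0), P1 sub-line F-4 layer 2, sub-stub (II-c₂)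
`stub_IIc_smooth` of `Summits/…/Cruxes/HDel/Lines/F4LinearRigidificationII.lean` ED. 2 (letter token for token); the typer՚s seed
`typers/B-typ03/F4/IIc2LawLocusSmooth.seed.B-typ03g19.lean` ead7d3e0 turned into a tree file BY IMPORT over ★ files only (ed. 3: the Cor. 6.6
helper `grpObj_pullback_eq_of_one_fst_eq` is imported from ★ `AbelianSchemes/GroupLawLocusOpenImmersion` (p793304); that §1 never needed
`exists_inducedLaw_of_point` is F0P1a-p03 (g0)՚s observation 22:12:26Z).  HC_CM is proved only modulo the 7 printed
citations until rung 0 closes; nothing here is about HC.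

THE STATEMENT.  `p : X → S` proper and smooth with geometrically connected fibres over a locally Noetherian `ℚ`-scheme `S`, with a section `ε`;
`ω : Z → S` locally of finite type carrying a group law `G_Z` on `X ×_S Z → Z` with unit `ε_Z` such that, on locally Noetherian `T → S`,
(A) every `T`-point of `Z` induces (intertwining through the comparison map `κ`) a group law on `X ×_S T` with unit `ε_T` and (B) every such law
is induced by a UNIQUE `T`-point.  HYPOTHESIS `hIIa` = [MumfordFogartyKirwan1994] Prop. 6.15 (p. 124) in the cell՚s letter (`stub_IIa` of the F-4
line ED. 2, VERBATIM as an explicit hypothesis — it is being proved separately: (E) the law lifts as a morphism, B-p01 (g16); ★-in-HOME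
`AbelianSchemeOver.exists_grpObj_isBaseChangeVia_of_lift`, B-p04 (g22)): over an Artin local `ℚ`-algebra `A` with `𝔪J = 0`, an abelian-scheme
structure on `X ×_A (A⧸J)` with unit `ε|` extends to one on `X` with unit `ε` of which it is the base change.  CONCLUSION: `ω` is SMOOTH.

THE PROOF (print p. 126 + [EGAIV4] Prop. (17.14.2)).  By ★ `Morphisms.smooth_of_artinianLifts` it suffices to lift every Artinian point
`w₀ : Spec (A⧸J) → Z` over `a : Spec A → S` (`A` Artin local, `J` proper, `𝔪J = 0`; `A` is a `ℚ`-algebra through `S → Spec ℚ`).  By (A), `w₀`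
induces a group law `G₀` on `X ×_S Spec (A⧸J)` with unit `ε`; packaged as an abelian scheme `A₀` over `Spec (A⧸J)` whose underlying scheme is the
base change of `X_A := X ×_S Spec A` (the cartesian square `X_{A⧸J} → X_A`), `hIIa` extends it to a group law `G` on `X_A` with unit `ε_A` OF WHICH
`A₀` IS THE BASE CHANGE; by (B) at `T = Spec A`, `G` is induced by some `w : Spec A → Z` over `a`; and `w|_{A⧸J} = w₀` by the UNIQUENESS in (B) at
`T = Spec (A⧸J)`: both points induce, through their comparison maps, group laws on `X_{A⧸J}` with unit `ε` — the law induced by `w|` (clause (A)) and `G₀` — and two such laws COINCIDE (★ `grpObj_pullback_eq_of_one_fst_eq`, [MumfordFogartyKirwan1994] Cor. 6.6 over the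
Artinian base), so both points induce `G₀` and are equal.

## References
* [MumfordFogartyKirwan1994] D. Mumford, J. Fogarty, F. Kirwan, *Geometric Invariant Theory*, 3rd ed. (1994), Ch. 6 §3 Prop. 6.15 (p. 124),
  Prop. 6.16 and its proof (p. 126); §1 Cor. 6.6 (p. 117).
* [EGAIV4] A. Grothendieck, J. Dieudonné, *Éléments de géométrie algébrique* IV₄, Publ. Math. IHÉS 32 (1967), Prop. (17.14.2) (p. 98).
-/

noncomputable section

-- Mathlib's `Over`/pull-back API is stated across semireducible wrappers (as in the ★ `AbelianSchemes/*` files).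
set_option backward.isDefEq.respectTransparency false

open CategoryTheory CategoryTheory.Limits AlgebraicGeometry IsLocalRing TopologicalSpace MonoidalCategory
open Literature.AlgebraicGeometry.Morphisms (smooth_of_artinianLifts)

namespace Literature.AlgebraicGeometry.AbelianSchemes

open scoped MonObj

/-! ## The theorem -/

/-- **(II-c₂) PROVED MODULO (II-a): the law locus is smooth** ([MumfordFogartyKirwan1994] Ch. 6 §3, proof of Prop. 6.16, p. 126: «Proposition
6.15 is precisely the criterion for `ω̄` to be smooth»; [EGA IV₄ (17.14.2)]).  Conclusion = menu letter `stub_IIc_smooth` token for token; hypothesis =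
menu letter `stub_IIa`.  See the module docstring for the argument.
[cite: MumfordFogartyKirwan1994, Ch. 6 §3 Proposition 6.16, proof (p. 126), Proposition 6.15 (p. 124)] [cite: EGAIV4, Prop. (17.14.2), p. 98] -/
theorem groupLawLocus_smooth_of_infinitesimalLifting
    (hIIa : ∀ (A : Type) [CommRing A] [IsArtinianRing A] [IsLocalRing A] [Algebra ℚ A] (J : Ideal A),
      J ≠ ⊤ → IsLocalRing.maximalIdeal A * J = ⊥ →
      ∀ (X : Over (Spec (.of A))) [IsProper X.hom] [Smooth X.hom] [GeometricallyConnected X.hom]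
        (ε : Spec (.of A) ⟶ X.left) (_ : ε ≫ X.hom = 𝟙 _)
        (A₀ : AbelianSchemeOver (Spec (.of (A ⧸ J)))) (G : A₀.X.left ⟶ X.left)
        (_ : IsPullback G A₀.X.hom X.hom (Spec.map (CommRingCat.ofHom (Ideal.Quotient.mk J))))
        (_ : (η[A₀.X]).left ≫ G = Spec.map (CommRingCat.ofHom (Ideal.Quotient.mk J)) ≫ ε),
      ∃ GX : GrpObj X, (@MonObj.one _ _ _ X GX.toMonObj).left = ε ∧
        A₀.IsBaseChangeVia (@AbelianSchemeOver.mk _ X GX ‹_› ‹_› ‹_›)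
          (Spec.map (CommRingCat.ofHom (Ideal.Quotient.mk J))) G) : ∀ ⦃S X : Scheme.{0}⦄ [IsLocallyNoetherian S] (p : X ⟶ S) [IsProper p] [Smooth p]
    [GeometricallyConnected p] (_ : S ⟶ Spec (.of ℚ)) (ε : S ⟶ X) (_ : ε ≫ p = 𝟙 S)
    ⦃Z : Scheme.{0}⦄ (ω : Z ⟶ S) [LocallyOfFiniteType ω] (GZ : GrpObj (Over.mk (pullback.snd p ω)))
    (_ : (@MonObj.one _ _ _ (Over.mk (pullback.snd p ω)) GZ.toMonObj).left ≫ pullback.fst p ω = ω ≫ ε)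
    (_ : ∀ ⦃T : Scheme.{0}⦄ [IsLocallyNoetherian T] (v : T ⟶ S),
        (∀ (w : T ⟶ Z), w ≫ ω = v →
          ∀ (κ : pullback p v ⟶ pullback p ω), κ ≫ pullback.fst p ω = pullback.fst p v →
            ∀ (hκ : κ ≫ pullback.snd p ω = pullback.snd p v ≫ w),
            ∃ G' : GrpObj (Over.mk (pullback.snd p v)),
              (@MonObj.one _ _ _ (Over.mk (pullback.snd p v)) G'.toMonObj).left ≫ pullback.fst p v = v ≫ ε ∧
              (@MonObj.one _ _ _ (Over.mk (pullback.snd p v)) G'.toMonObj).left ≫ κ =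
                w ≫ (@MonObj.one _ _ _ (Over.mk (pullback.snd p ω)) GZ.toMonObj).left ∧
              (@MonObj.mul _ _ _ (Over.mk (pullback.snd p v)) G'.toMonObj).left ≫ κ =
                pullback.map (pullback.snd p v) (pullback.snd p v) (pullback.snd p ω) (pullback.snd p ω) κ κ w
                  hκ.symm hκ.symm ≫ (@MonObj.mul _ _ _ (Over.mk (pullback.snd p ω)) GZ.toMonObj).left) ∧
        (∀ G' : GrpObj (Over.mk (pullback.snd p v)),
          (@MonObj.one _ _ _ (Over.mk (pullback.snd p v)) G'.toMonObj).left ≫ pullback.fst p v = v ≫ ε →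
          ∃! w : T ⟶ Z, w ≫ ω = v ∧
            ∀ (κ : pullback p v ⟶ pullback p ω), κ ≫ pullback.fst p ω = pullback.fst p v →
              ∀ (hκ : κ ≫ pullback.snd p ω = pullback.snd p v ≫ w),
              (@MonObj.one _ _ _ (Over.mk (pullback.snd p v)) G'.toMonObj).left ≫ κ =
                w ≫ (@MonObj.one _ _ _ (Over.mk (pullback.snd p ω)) GZ.toMonObj).left ∧
              (@MonObj.mul _ _ _ (Over.mk (pullback.snd p v)) G'.toMonObj).left ≫ κ =
                pullback.map (pullback.snd p v) (pullback.snd p v) (pullback.snd p ω) (pullback.snd p ω) κ κ w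
                  hκ.symm hκ.symm ≫ (@MonObj.mul _ _ _ (Over.mk (pullback.snd p ω)) GZ.toMonObj).left)),
    Smooth ω := by
  intro S X _ p _ _ _ f ε hε Z ω _ GZ hunit hrep
  refine Literature.AlgebraicGeometry.Morphisms.smooth_of_artinianLifts ω fun A _ _ _ J hJ hmJ a z₀ hz₀ => ?_
  -- the two Artinian test schemes
  let i : Spec (CommRingCat.of (A ⧸ J)) ⟶ Spec (CommRingCat.of A) := Spec.map (CommRingCat.ofHom (Ideal.Quotient.mk J))
  let v₀ : Spec (CommRingCat.of (A ⧸ J)) ⟶ S := i ≫ a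
  have hz₀' : z₀ ≫ ω = v₀ := hz₀
  -- `A` is a `ℚ`-algebra through `a ≫ f` ((G4))
  letI : Algebra ℚ A := (Spec.preimage (a ≫ f)).hom.toAlgebra
  -- (A) at `Spec (A⧸J)`: the law induced by `z₀` on `X ×_S Spec (A⧸J)`
  let κ₀ : pullback p v₀ ⟶ pullback p ω := pullback.map p v₀ p ω (𝟙 X) z₀ (𝟙 S) (by simp) (by simpa using hz₀'.symm)
  obtain ⟨G₀, hu₀, -, -⟩ := (hrep v₀).1 z₀ hz₀' κ₀ (by simp [κ₀]) (by simp [κ₀])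
  -- the deformation problem over `Spec A`: `X_a := X ×_S Spec A` with the section `ε_a`
  haveI : IsProper (Over.mk (pullback.snd p a)).hom := show IsProper (pullback.snd p a) from inferInstance
  haveI : Smooth (Over.mk (pullback.snd p a)).hom := show Smooth (pullback.snd p a) from inferInstance
  haveI : GeometricallyConnected (Over.mk (pullback.snd p a)).hom :=
    show GeometricallyConnected (pullback.snd p a) from inferInstance
  let εa : Spec (CommRingCat.of A) ⟶ pullback p a :=
    pullback.lift (a ≫ ε) (𝟙 _) (by rw [Category.assoc, hε, Category.comp_id, Category.id_comp])
  have hεa : εa ≫ (Over.mk (pullback.snd p a)).hom = 𝟙 _ := pullback.lift_snd _ _ _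
  let A₀ : AbelianSchemeOver (Spec (.of (A ⧸ J))) := @AbelianSchemeOver.mk _ (Over.mk (pullback.snd p v₀)) G₀
    (show IsProper (pullback.snd p v₀) from inferInstance) (show Smooth (pullback.snd p v₀) from inferInstance)
    (show GeometricallyConnected (pullback.snd p v₀) from inferInstance)
  let G : pullback p v₀ ⟶ pullback p a := pullback.map p v₀ p a (𝟙 X) i (𝟙 S) (by simp) (by simp [v₀])
  have hG₁ : G ≫ pullback.fst p a = pullback.fst p v₀ := by simp [G]
  have hG₂ : G ≫ pullback.snd p a = pullback.snd p v₀ ≫ i := by simp [G]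
  have big : IsPullback (G ≫ pullback.fst p a) (pullback.snd p v₀) p (i ≫ a) := by
    rw [hG₁]; exact IsPullback.of_hasPullback p v₀
  have hG : IsPullback G (Over.mk (pullback.snd p v₀)).hom (Over.mk (pullback.snd p a)).hom i :=
    IsPullback.of_right big hG₂ (IsPullback.of_hasPullback p a)
  -- the unit of the induced law is the restriction of `ε_a`
  have hu₀snd : (@MonObj.one _ _ _ (Over.mk (pullback.snd p v₀)) G₀.toMonObj).left ≫ pullback.snd p v₀ = 𝟙 _ := by
    have e := Over.w (@MonObj.one _ _ _ (Over.mk (pullback.snd p v₀)) G₀.toMonObj)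
    simp only [Over.mk_hom] at e
    exact e
  have hηε : (η[A₀.X]).left ≫ G = i ≫ εa := by
    apply pullback.hom_ext
    · rw [Category.assoc, hG₁, Category.assoc, pullback.lift_fst]
      exact hu₀
    · rw [Category.assoc, hG₂, Category.assoc, pullback.lift_snd, Category.comp_id, reassoc_of% hu₀snd]
  -- (II-a): the law of `A₀` extends to an abelian-scheme law `GX` on `X_a` with unit `ε_a`
  obtain ⟨GX, h1, h2⟩ := hIIa A J hJ hmJ (Over.mk (pullback.snd p a)) εa hεa A₀ G hG hηε
  unfold AbelianSchemeOver.IsBaseChangeVia at h2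
  obtain ⟨hGw, -, hηX, hμX⟩ := h2
  -- (B) at `Spec A`: `GX` is induced by a unique `w : Spec A → Z` over `a`
  have hunitX : (@MonObj.one _ _ _ (Over.mk (pullback.snd p a)) GX.toMonObj).left ≫ pullback.fst p a = a ≫ ε := by
    rw [h1]; exact pullback.lift_fst _ _ _
  obtain ⟨w, ⟨hw, hwP⟩, -⟩ := (hrep a).2 GX hunitX
  refine ⟨w, hw, ?_⟩
  -- `w` restricts to `z₀`: both are THE point of (B) at `Spec (A⧸J)` for the law `G₀`
  obtain ⟨w₀, -, huniq₀⟩ := (hrep v₀).2 G₀ hu₀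
  have P₀ : z₀ ≫ ω = v₀ ∧ ∀ (κ : pullback p v₀ ⟶ pullback p ω), κ ≫ pullback.fst p ω = pullback.fst p v₀ →
      ∀ (hκ : κ ≫ pullback.snd p ω = pullback.snd p v₀ ≫ z₀),
      (@MonObj.one _ _ _ (Over.mk (pullback.snd p v₀)) G₀.toMonObj).left ≫ κ =
        z₀ ≫ (@MonObj.one _ _ _ (Over.mk (pullback.snd p ω)) GZ.toMonObj).left ∧
      (@MonObj.mul _ _ _ (Over.mk (pullback.snd p v₀)) G₀.toMonObj).left ≫ κ =
        pullback.map (pullback.snd p v₀) (pullback.snd p v₀) (pullback.snd p ω) (pullback.snd p ω) κ κ z₀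
          hκ.symm hκ.symm ≫ (@MonObj.mul _ _ _ (Over.mk (pullback.snd p ω)) GZ.toMonObj).left := by
    refine ⟨hz₀', fun κ hκ₁ hκ₂ => ?_⟩
    obtain ⟨G', hu', hc'⟩ := (hrep v₀).1 z₀ hz₀' κ hκ₁ hκ₂
    obtain rfl : G' = G₀ := grpObj_pullback_eq_of_one_fst_eq p ε v₀ G' G₀ hu' hu₀
    exact hc'
  -- the canonical `κ₁` for `w` and its intertwining with `GX`
  let κ₁ : pullback p a ⟶ pullback p ω := pullback.map p a p ω (𝟙 X) w (𝟙 S) (by simp) (by simpa using hw.symm)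
  have hκ₁₁ : κ₁ ≫ pullback.fst p ω = pullback.fst p a := by simp [κ₁]
  have hκ₁₂ : κ₁ ≫ pullback.snd p ω = pullback.snd p a ≫ w := by simp [κ₁]
  obtain ⟨hηX1, hμX1⟩ := hwP κ₁ hκ₁₁ hκ₁₂
  -- restate the (II-a) intertwinings with the pull-back projections spelled out
  have hηX' : (@MonObj.one _ _ _ (Over.mk (pullback.snd p v₀)) G₀.toMonObj).left ≫ G =
      i ≫ (@MonObj.one _ _ _ (Over.mk (pullback.snd p a)) GX.toMonObj).left := hηX
  have hμX' : (@MonObj.mul _ _ _ (Over.mk (pullback.snd p v₀)) G₀.toMonObj).left ≫ G =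
      pullback.map (pullback.snd p v₀) (pullback.snd p v₀) (pullback.snd p a) (pullback.snd p a) G G i hG₂.symm hG₂.symm ≫
        (@MonObj.mul _ _ _ (Over.mk (pullback.snd p a)) GX.toMonObj).left := hμX
  have P₁ : (i ≫ w) ≫ ω = v₀ ∧ ∀ (κ : pullback p v₀ ⟶ pullback p ω), κ ≫ pullback.fst p ω = pullback.fst p v₀ →
      ∀ (hκ : κ ≫ pullback.snd p ω = pullback.snd p v₀ ≫ (i ≫ w)),
      (@MonObj.one _ _ _ (Over.mk (pullback.snd p v₀)) G₀.toMonObj).left ≫ κ =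
        (i ≫ w) ≫ (@MonObj.one _ _ _ (Over.mk (pullback.snd p ω)) GZ.toMonObj).left ∧
      (@MonObj.mul _ _ _ (Over.mk (pullback.snd p v₀)) G₀.toMonObj).left ≫ κ =
        pullback.map (pullback.snd p v₀) (pullback.snd p v₀) (pullback.snd p ω) (pullback.snd p ω) κ κ (i ≫ w)
          hκ.symm hκ.symm ≫ (@MonObj.mul _ _ _ (Over.mk (pullback.snd p ω)) GZ.toMonObj).left := by
    refine ⟨by rw [Category.assoc, hw], fun κ hκ₁ hκ₂ => ?_⟩
    -- `κ = G ≫ κ₁`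
    obtain rfl : κ = G ≫ κ₁ := by
      apply pullback.hom_ext
      · rw [hκ₁, Category.assoc, hκ₁₁, hG₁]
      · rw [hκ₂, Category.assoc, hκ₁₂, reassoc_of% hG₂]
    refine ⟨?_, ?_⟩
    · rw [reassoc_of% hηX', hηX1, Category.assoc]
    · rw [reassoc_of% hμX', hμX1, ← Category.assoc]
      congr 1
      apply pullback.hom_ext
      · simp only [Category.assoc, pullback.lift_fst, pullback.lift_fst_assoc]
      · simp only [Category.assoc, pullback.lift_snd, pullback.lift_snd_assoc]
  exact (huniq₀ _ P₁).trans (huniq₀ _ P₀).symm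

end Literature.AlgebraicGeometry.AbelianSchemes

end
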